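import Summits.QuantumFields.BalabanUV.T4Continuum.Support.NE7K1LinBoxThm110Step

/-!
# NE7K1LinBoxThm110 — row NE7 (node U5), candidate route HOM, path H1L, cell K1-lin(s): card §3y STEP 7, PART 5 —
# B4 THEOREM (1.10), VALUE CLAUSE, FOR THE TWO-CUTOFF LINE ON NEUMANN BOXES AT `A = 0`, EVERY SCALE `k ≥ 1` (η = L^{−k}),
# EVERY `s ∈ [0,1]`: `|(G^Π_k(s)f)(x)| ≤ c₀e^{−δ₀dist_η(x, supp f)}‖f‖_∞`, `(c₀, δ₀)` IN `(d, L, a±)` ONLY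

Lineage `b2b-balaban-t4-ne7-p2` (CRUX PROVER NE7 #2), generation 79; file 98 (the end of STEP 7's value clause: files 94–98).  Card
`K1LIN-LINE.md` v1.21 §3y: «STEP 7 — B4 THEOREM (1.9)∕(1.10)'s REGULARITY HALF (L^∞ with the local singularity, ∇G(s), Hölder quotients
of ∇G(s)) FOR THE LINE AT A = 0: PARAMETRIC — NOT IN TREE for the line … This is the ONLY licence-free, line-specific one-scale letter
not in kernel».  THIS FILE puts its `L^∞` VALUE clause in kernel: b04's `B4Thm110ZeroBox` §§9–11 re-run on the line's tower of
files 95–97 — the induction over `j` (base = file 95's `boxLine_L_inv_decay`, step = file 97's `step_term_bound_line`, the geometric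
series `Σ_j L^{−2(k−j)} ≤ 1∕3`), then the printed forms through b04's `mulVec_le_of_roww` ∕ `rowSum_le_roww` ∕ `colSum_le_roww` ∕ `dsupp`
∕ `cK` ∕ `aSeq_div_cK` BY NAME.

* §1 **`GfineL_roww_bound`**: `Σ_{x′}|𝒢_j(s)(x,x′)|e^{δ₀|x−x′|_∞∕L^k} ≤ c₀` for every `k ≥ 1`, `1 ≤ j ≤ k`, `a ∈ [a₋,a₊]`, `s ∈ [0,1]`, box.
* §2 **`thm110_line_box_roww`** — (1.10)'s value clause for `G^Π_k(s) = (boxLine(L^k, M, a_k, s))⁻¹` in weighted-row form.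
* §3 **`thm110_line_box_value ∕ _dist`** (the printed shape `|(G^Π_k(s)f)(x)| ≤ c₀e^{−δ₀dist_η(x, supp f)}·F`), **`lemma22_line_box_rowSum ∕
  _colSum ∕ _sup`** (B4 Lemma 2.2 (2.17) at `p = q ∈ {1, ∞}` for the line).
* §4 **`thm110_line_box_roww_coeff ∕ _value_coeff`** — the same for the box line with the LITERAL averaging coefficient `a ∈ [a₋,a₊]`
  (the object `boxLine L hn M a s` of files 80–93), every `s ∈ [0,1]`.
* §5 non-vacuity at `d + 1 = 4`, `L = 2`.
CONSTANTS: `(δ₀, c₀)` existential, closed terms in `(d, ℓ, a₋, a₊)` — NO `s`, `k`, box ((k1)); `s` enters only through `0 ≤ s ≤ 1` ((k2)).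

WHAT STEP 7 STILL LACKS after this file (HONEST): the DERIVATIVE clause of (1.10) (`|(D^η_μG^Π_k(s)f)(x)|`; b04's
`B4Thm110ZeroBoxDeriv` route with (2.35)'s second quantity for the line = file 79's `boxResolventKernel_step_decay`), the Hölder clause
(1.9) (b04's `B4Thm19ZeroBoxHolder`), the torus variant, general regions (b04: boxes only as well), and A ≠ 0 (licence X-A7).

HONEST FRAMING: [folklore]; A = 0; the LINE is not in [B4] — the print's box route transposed; nothing of Bałaban's asserted; no
`sorry`.  Census only (STEP 7, value clause); NE7 NOT PRINTED ∕ NOT PROVED; spine 0∕9; FIXED FINITE T⁴, rung (B)+1; NOT infinite volume,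
NOT mass gap, NOT Clay.  HONEST DEPENDENCY: continuum YM on T⁴ ⇐ BetaPertH ∧ nine spine estimates (0/9 proved); BetaPertH ⇐ (D1) ∧ (D4)
∧ CAP+tail; G-an2-4 gates asym, D1 and NE2/3/4.
-/

noncomputable section

open Finset Matrix

namespace Summit.QuantumFields.BalabanUV.T4Continuum.NE7K1LinBoxThm110

open Literature.MathematicalPhysics.QuantumFieldTheory.Balaban1983to89
open Literature.MathematicalPhysics.QuantumFieldTheory.Balaban1983to89.B4Reflection242
open Literature.MathematicalPhysics.QuantumFieldTheory.Balaban1983to89.B4Lower18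
open Literature.MathematicalPhysics.QuantumFieldTheory.Balaban1983to89.B4ContourShift (supNorm supNorm_nonneg)
open Literature.MathematicalPhysics.QuantumFieldTheory.Balaban1983to89.B4BoxCov237
open Literature.MathematicalPhysics.QuantumFieldTheory.Balaban1983to89.B4Thm110ZeroBox
open Literature.MathematicalPhysics.QuantumFieldTheory.Balaban1983to89.B4Sect5Proof (latticeConst latticeConst_nonneg latticeSum_le)
open NE7K1LinSchurLineU1 NE7K1LinSchurFoldBox NE7K1LinBoxCovEnergy NE7K1LinLineLaplacian NE7K1LinBoxCov237 NE7K1LinBoxScales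
open NE7K1LinBoxRGStep NE7K1LinBoxThm110Step

variable {d : ℕ}

/-! ### §1 The induction over `j`: `‖𝒢_j(s)‖_{row,δ₀} ≤ B₁ + Θe^{δ₀}·Σ_{i<j}L^{-2(k-i)}` -/

set_option maxHeartbeats 800000 in
/-- **UNIFORM WEIGHTED ROW BOUND FOR ALL THE LINE's PROPAGATORS `𝒢_j(s)`, `1 ≤ j ≤ k`**: there are `δ₀ > 0`, `c₀ > 0`
(depending on `d, ℓ` and the window `[a₋,a₊]` only) with `Σ_{x′}|𝒢_j(s)(x,x′)|e^{δ₀|x−x′|_∞/L^k} ≤ c₀` for every box, every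
`k ≥ 1`, every `1 ≤ j ≤ k` AND EVERY `s ∈ [0,1]` — by induction over `j` from the base (file 95's `boxLine_L_inv_decay`, through
`GfineL_apply` ∕ `GfineL_top`) with the summable steps of file 97 (`Σ_j L^{-2(k-j)} ≤ L^{-2}/(1 − L^{-2}) ≤ 1/3`); b04's
`Gfine_roww_bound` re-run. [folklore] -/
theorem GfineL_roww_bound (d ℓ : ℕ) (hℓ : 1 ≤ ℓ) (amin aplus : ℝ) (ha : 0 < amin) :
    ∃ δ₀ c₀ : ℝ, 0 < δ₀ ∧ 0 < c₀ ∧ ∀ (k : ℕ), 1 ≤ k → ∀ (j : ℕ), 1 ≤ j → j ≤ k →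
      ∀ (a s : ℝ), amin ≤ a → a ≤ aplus → 0 ≤ s → s ≤ 1 → ∀ (M : Fin (d + 1) → ℕ),
        (∀ i, 1 ≤ M i) → ∀ x : ↥(boxDom (Nf ℓ k M)), roww δ₀ ((ℓ + 1) ^ k) (GfineL ℓ k M j a s) x ≤ c₀ := by
  obtain ⟨r, C₀, hr, hC₀, hdec⟩ := boxLine_L_inv_decay d ℓ (amin * (1 - ((((ℓ : ℝ) + 1)) ^ 2)⁻¹))
    aplus (aminus'_pos hℓ ha)
  obtain ⟨κ₀, Θ, hκ₀, hΘ, hstep⟩ := step_term_bound_line d ℓ hℓ amin aplus ha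
  set δ₀ : ℝ := min (r / 2) κ₀ with hδ₀
  have hδ0 : 0 < δ₀ := lt_min (half_pos hr) hκ₀
  have hδr : δ₀ ≤ r / 2 := min_le_left _ _
  have hδκ : δ₀ ≤ κ₀ := min_le_right _ _
  have hK1 := one_le_latticeConst d (half_pos hr)
  set B₁ : ℝ := C₀ * latticeConst (d + 1) (r / 2) with hB₁
  have hB₁0 : 0 < B₁ := mul_pos hC₀ (by linarith)
  refine ⟨δ₀, B₁ + Θ * Real.exp δ₀, hδ0, by positivity, ?_⟩
  intro k hk j hj1 hjk a s h1 h2 h3 h4 M hM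
  have ha0 : 0 < a := lt_of_lt_of_le ha h1
  have hL := one_lt_L_real hℓ
  set q : ℝ := (((ℓ : ℝ) + 1) ^ 2)⁻¹ with hq
  have hL2 : (4 : ℝ) ≤ ((ℓ : ℝ) + 1) ^ 2 := by
    have : (1 : ℝ) ≤ ℓ := by exact_mod_cast hℓ
    nlinarith
  have hq0 : 0 < q := by positivity
  have hq4 : q ≤ 1 / 4 := by
    rw [hq]
    calc (((ℓ : ℝ) + 1) ^ 2)⁻¹ ≤ (4 : ℝ)⁻¹ := by
          exact inv_anti₀ (by norm_num) hL2
      _ = 1 / 4 := by norm_num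
  have hq1 : 0 < 1 - q := by linarith
  have hnk : 1 ≤ (ℓ + 1) ^ k := Nat.one_le_pow _ _ (by omega)
  -- the inductive claim
  have main : ∀ j, 1 ≤ j → j ≤ k → ∀ x : ↥(boxDom (Nf ℓ k M)),
      roww δ₀ ((ℓ + 1) ^ k) (GfineL ℓ k M j a s) x ≤ B₁ + Θ * Real.exp δ₀ * (q * (sc ℓ k j ^ 2)⁻¹ / (1 - q)) := by
    intro j hj1
    induction j, hj1 using Nat.le_induction with
    | base =>
      intro _ x
      obtain ⟨hw1, hw2, hapos⟩ := aSeq_window hℓ ha h1 h2 (le_refl 1)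
      have hT : ∀ x y : ↥(boxDom (Nf ℓ k M)),
          |GfineL ℓ k M 1 a s x y| ≤ C₀ * Real.exp (-(r * supNorm (x.1 - y.1))) := by
        intro x y
        rcases Nat.lt_or_ge k 2 with hk2 | hk2
        · obtain rfl : k = 1 := by omega
          rw [GfineL_top]
          exact hdec ((ℓ + 1) ^ 1) (Nat.one_le_pow 1 (ℓ + 1) (Nat.succ_pos ℓ)) (pow_one _) _ _ hw1 hw2 h3 h4 M x y
        · have hs : 0 < sc ℓ k 1 ^ 2 := pow_pos (sc_pos ℓ k 1) 2
          rw [GfineL_apply hℓ (le_refl 1) hk2 hM ha0 h3 h4 x y, abs_mul, abs_of_pos (inv_pos.2 hs)]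
          have hd := hdec (bj ℓ 1) (bj_pos ℓ 1) (pow_one _) _ _ hw1 hw2 h3 h4 (Mj ℓ k M 1)
            ((ej ℓ k M 1 hk2).symm x) ((ej ℓ k M 1 hk2).symm y)
          have hsi1 : (sc ℓ k 1 ^ 2)⁻¹ ≤ 1 := inv_le_one_of_one_le₀ (one_le_pow₀ (one_le_sc ℓ k 1))
          calc (sc ℓ k 1 ^ 2)⁻¹ * |(boxLine (ℓ + 1) (bj_pos ℓ 1) (Mj ℓ k M 1) (B1.aSeq a ((ℓ : ℝ) + 1) 1) s)⁻¹
                  ((ej ℓ k M 1 hk2).symm x) ((ej ℓ k M 1 hk2).symm y)|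
              ≤ 1 * (C₀ * Real.exp (-(r * supNorm (x.1 - y.1)))) :=
                mul_le_mul hsi1 hd (abs_nonneg _) zero_le_one
            _ = _ := one_mul _
      calc roww δ₀ ((ℓ + 1) ^ k) (GfineL ℓ k M 1 a s) x ≤ C₀ * latticeConst (d + 1) (r / 2) :=
            roww_le_of_decay hnk hC₀.le hr hδ0.le hδr hT x
        _ ≤ B₁ + Θ * Real.exp δ₀ * (q * (sc ℓ k 1 ^ 2)⁻¹ / (1 - q)) := by
            rw [hB₁]
            have : 0 ≤ Θ * Real.exp δ₀ * (q * (sc ℓ k 1 ^ 2)⁻¹ / (1 - q)) := by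
              have := pow_pos (sc_pos ℓ k 1) 2
              positivity
            linarith
    | succ j hj1 ih =>
      intro hjk x
      have hprev := ih (by omega) x
      have hst := hstep δ₀ hδ0.le hδκ k j hj1 hjk a s h1 h2 h3 h4 M hM x
      have hsplit : GfineL ℓ k M (j + 1) a s
          = (GfineL ℓ k M (j + 1) a s - GfineL ℓ k M j a s) + GfineL ℓ k M j a s := (sub_add_cancel _ _).symm
      rw [hsplit]
      calc roww δ₀ ((ℓ + 1) ^ k) ((GfineL ℓ k M (j + 1) a s - GfineL ℓ k M j a s) + GfineL ℓ k M j a s) x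
          ≤ roww δ₀ ((ℓ + 1) ^ k) (GfineL ℓ k M (j + 1) a s - GfineL ℓ k M j a s) x
              + roww δ₀ ((ℓ + 1) ^ k) (GfineL ℓ k M j a s) x := roww_add_le _ _ _ _ _
        _ ≤ Θ * Real.exp δ₀ * (sc ℓ k j ^ 2)⁻¹ + (B₁ + Θ * Real.exp δ₀ * (q * (sc ℓ k j ^ 2)⁻¹ / (1 - q))) :=
            add_le_add hst hprev
        _ = B₁ + Θ * Real.exp δ₀ * (q * (sc ℓ k (j + 1) ^ 2)⁻¹ / (1 - q)) := by
            rw [sc_sq_inv_succ hjk, ← hq]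
            field_simp
            ring
  intro x
  have hm := main j hj1 hjk x
  have hs1 : (sc ℓ k j ^ 2)⁻¹ ≤ 1 := inv_le_one_of_one_le₀ (one_le_pow₀ (one_le_sc ℓ k j))
  have hs0 : 0 < (sc ℓ k j ^ 2)⁻¹ := inv_pos.2 (pow_pos (sc_pos ℓ k j) 2)
  have hgeo : q * (sc ℓ k j ^ 2)⁻¹ / (1 - q) ≤ 1 := by
    rw [div_le_one hq1]
    calc q * (sc ℓ k j ^ 2)⁻¹ ≤ q * 1 := mul_le_mul_of_nonneg_left hs1 hq0.le
      _ ≤ 1 - q := by linarith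
  have hΘe : 0 ≤ Θ * Real.exp δ₀ := by positivity
  have hfin := mul_le_of_le_one_right hΘe hgeo
  linarith

/-! ### §2 THEOREM (1.10) of [B4], VALUE CLAUSE, FOR THE TWO-CUTOFF LINE on boxes: the decay of `G^Π_k(s) = 𝒢_k(s)` -/

/-- **[B4] p. 573 THEOREM, inequality (1.10), VALUE CLAUSE, FOR THE TWO-CUTOFF LINE at `A = 0` on rectangular parallelepipeds
`Ω = □`** (weighted-row form, slightly stronger than the pointwise statement): there are `δ₀ > 0`, `c₀ > 0` depending only on `d`,
`L = ℓ + 1` and the window `[a₋, a₊]` such that for every `k ≥ 1` (lattice spacing `η = L^{-k}`), every `a` in the window, EVERY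
`s ∈ [0,1]`, every box `□` of side lengths `M_μ` (`M_μ ≥ 1`) and every point `x`,
`Σ_{x′ ∈ □} |G^Π_k(s; x, x′)|·e^{δ₀·dist(x,x′)} ≤ c₀`, where `G^Π_k(s) = (boxLine(L^k, M, a_k, s))⁻¹ = (T^Π(s) + a_kQ_k^*Q_k)⁻¹`
is the two-cutoff line's propagator on the Neumann box in values form (`= 𝒢_k(s)`, `GfineL_top`) and `dist = |·|_∞/L^k`.
HONEST LABEL: the LINE is not in [B4]; proved here by the argument of [B4] pp. 582–583 ((2.34)–(2.37)) transposed to the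
line (files 94–97), from the tree's (2.35)∕(2.37) for the line (files 77 ∕ 81). [cite: Balaban1983RegularityDecay, p. 573 Theorem
(1.10); pp. 582–583 (2.34)–(2.37), for the two-cutoff line] -/
theorem thm110_line_box_roww (d ℓ : ℕ) (hℓ : 1 ≤ ℓ) (amin aplus : ℝ) (ha : 0 < amin) :
    ∃ δ₀ c₀ : ℝ, 0 < δ₀ ∧ 0 < c₀ ∧ ∀ (k : ℕ), 1 ≤ k → ∀ (a s : ℝ), amin ≤ a → a ≤ aplus → 0 ≤ s →
      s ≤ 1 → ∀ (M : Fin (d + 1) → ℕ), (∀ i, 1 ≤ M i) →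
        ∀ x : ↥(boxDom (fun i => (ℓ + 1) ^ k * M i)),
          ∑ x', |(boxLine (ℓ + 1) (Nat.one_le_pow k (ℓ + 1) (Nat.succ_pos ℓ)) M (B1.aSeq a ((ℓ : ℝ) + 1) k) s)⁻¹ x x'|
              * Real.exp (δ₀ * supNorm (x.1 - x'.1) / (((ℓ + 1) ^ k : ℕ) : ℝ)) ≤ c₀ := by
  obtain ⟨δ₀, c₀, hδ, hc, h⟩ := GfineL_roww_bound d ℓ hℓ amin aplus ha
  refine ⟨δ₀, c₀, hδ, hc, fun k hk a s h1 h2 h3 h4 M hM x => ?_⟩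
  have hG : GfineL ℓ k M k a s = (boxLine (ℓ + 1) (Nat.one_le_pow k (ℓ + 1) (Nat.succ_pos ℓ)) M (B1.aSeq a ((ℓ : ℝ) + 1) k) s)⁻¹ :=
    GfineL_top ℓ k M a s
  have := h k hk k hk le_rfl a s h1 h2 h3 h4 M hM x
  rw [roww, hG] at this
  exact this


/-! ### §3 The printed forms: the value clause of (1.10) and Lemma 2.2 (2.16)∕(2.17) at `p = q ∈ {1, ∞}` for the line -/

/-- **THEOREM (1.10) OF [B4], THE PRINTED VALUE CLAUSE, FOR THE TWO-CUTOFF LINE at `A = 0` on rectangular parallelepipeds**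
`|(G^Π_k(s)f)(x)| ≤ c₀ exp(−δ₀ dist(x, supp f))‖f‖_∞` for ALL `x ∈ □`: there are `δ₀ > 0`, `c₀ > 0` depending only on `d`, `ℓ` and the
window such that for every `k ≥ 1` (`η = L^{-k}`), `a` in the window, EVERY `s ∈ [0,1]`, every box `□ = Π_μ[0, M_μ)` (`M_μ ≥ 1`),
every `f : □ ∩ ηℤ^{d+1} → ℝ`, every bound `F ≥ |f|` and every `D` with `D ≤ |x − x'|_∞` for all `x' ∈ supp f`:
`|(G^Π_k(s) f)(x)| ≤ c₀·e^{−δ₀ηD}·F` (b04's `mulVec_le_of_roww`). [cite: Balaban1983RegularityDecay, Theorem (Prop. 2.1 of [1])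
(1.10) p.573, for the two-cutoff line] -/
theorem thm110_line_box_value (d ℓ : ℕ) (hℓ : 1 ≤ ℓ) (amin aplus : ℝ) (ha : 0 < amin) :
    ∃ δ₀ c₀ : ℝ, 0 < δ₀ ∧ 0 < c₀ ∧ ∀ (k : ℕ), 1 ≤ k → ∀ (a s : ℝ), amin ≤ a → a ≤ aplus → 0 ≤ s →
      s ≤ 1 → ∀ (M : Fin (d + 1) → ℕ), (∀ i, 1 ≤ M i) →
      ∀ (f : ↥(boxDom (fun i => (ℓ + 1) ^ k * M i)) → ℝ) (F D : ℝ), (∀ x', |f x'| ≤ F) →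
      ∀ x : ↥(boxDom (fun i => (ℓ + 1) ^ k * M i)), (∀ x', f x' ≠ 0 → D ≤ supNorm (x.1 - x'.1)) →
        |((boxLine (ℓ + 1) (Nat.one_le_pow k (ℓ + 1) (Nat.succ_pos ℓ)) M (B1.aSeq a ((ℓ : ℝ) + 1) k) s)⁻¹ *ᵥ f) x|
          ≤ c₀ * Real.exp (-(δ₀ * D / (((ℓ + 1) ^ k : ℕ) : ℝ))) * F := by
  obtain ⟨δ₀, c₀, hδ0, hc0, h⟩ := thm110_line_box_roww d ℓ hℓ amin aplus ha
  refine ⟨δ₀, c₀, hδ0, hc0, ?_⟩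
  intro k hk a s h1 h2 h3 h4 M hM f F D hF x hD
  exact mulVec_le_of_roww hδ0.le _ _ x (h k hk a s h1 h2 h3 h4 M hM x) f hF hD

/-- **THE SAME WITH THE LITERAL `dist(x, supp f)`** (b04's `dsupp f x` = the `ℓ^∞` distance from `x` to `supp f` in fine-lattice
units): `|(G^Π_k(s) f)(x)| ≤ c₀e^{−δ₀η·dsupp f x}·F` for every `F ≥ |f|`, every `s ∈ [0,1]`.
[cite: Balaban1983RegularityDecay, Theorem (Prop. 2.1 of [1]) (1.10) p.573, for the two-cutoff line] -/
theorem thm110_line_box_dist (d ℓ : ℕ) (hℓ : 1 ≤ ℓ) (amin aplus : ℝ) (ha : 0 < amin) :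
    ∃ δ₀ c₀ : ℝ, 0 < δ₀ ∧ 0 < c₀ ∧ ∀ (k : ℕ), 1 ≤ k → ∀ (a s : ℝ), amin ≤ a → a ≤ aplus → 0 ≤ s →
      s ≤ 1 → ∀ (M : Fin (d + 1) → ℕ), (∀ i, 1 ≤ M i) →
      ∀ (f : ↥(boxDom (fun i => (ℓ + 1) ^ k * M i)) → ℝ) (F : ℝ), (∀ x', |f x'| ≤ F) →
      ∀ x : ↥(boxDom (fun i => (ℓ + 1) ^ k * M i)),
        |((boxLine (ℓ + 1) (Nat.one_le_pow k (ℓ + 1) (Nat.succ_pos ℓ)) M (B1.aSeq a ((ℓ : ℝ) + 1) k) s)⁻¹ *ᵥ f) x|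
          ≤ c₀ * Real.exp (-(δ₀ * dsupp f x / (((ℓ + 1) ^ k : ℕ) : ℝ))) * F := by
  obtain ⟨δ₀, c₀, hδ0, hc0, h⟩ := thm110_line_box_value d ℓ hℓ amin aplus ha
  refine ⟨δ₀, c₀, hδ0, hc0, ?_⟩
  intro k hk a s h1 h2 h3 h4 M hM f F hF x
  exact h k hk a s h1 h2 h3 h4 M hM f F (dsupp f x) hF x fun x' hx' => dsupp_le f x x' hx'

/-- **LEMMA 2.2 (2.17), `p = q = ∞`, FOR THE LINE at `A = 0`** (and the `sup|·|` part of (2.16)): `‖G^Π_k(s)‖_{∞→∞} ≤ c₀`, i.e.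
`Σ_{x'}|G^Π_k(s)(x,x')| ≤ c₀` for every `x`, uniformly in `k ≥ 1`, `s ∈ [0,1]`, the window and the box.
[cite: Balaban1983RegularityDecay, Lemma 2.2 (2.16)–(2.17) p.577–578, for the two-cutoff line] -/
theorem lemma22_line_box_rowSum (d ℓ : ℕ) (hℓ : 1 ≤ ℓ) (amin aplus : ℝ) (ha : 0 < amin) :
    ∃ c₀ : ℝ, 0 < c₀ ∧ ∀ (k : ℕ), 1 ≤ k → ∀ (a s : ℝ), amin ≤ a → a ≤ aplus → 0 ≤ s →
      s ≤ 1 → ∀ (M : Fin (d + 1) → ℕ), (∀ i, 1 ≤ M i) →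
      ∀ x : ↥(boxDom (fun i => (ℓ + 1) ^ k * M i)),
        ∑ x', |(boxLine (ℓ + 1) (Nat.one_le_pow k (ℓ + 1) (Nat.succ_pos ℓ)) M (B1.aSeq a ((ℓ : ℝ) + 1) k) s)⁻¹ x x'| ≤ c₀ := by
  obtain ⟨δ₀, c₀, hδ0, hc0, h⟩ := thm110_line_box_roww d ℓ hℓ amin aplus ha
  refine ⟨c₀, hc0, ?_⟩
  intro k hk a s h1 h2 h3 h4 M hM x
  exact (rowSum_le_roww hδ0.le _ _ x).trans (h k hk a s h1 h2 h3 h4 M hM x)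

/-- **LEMMA 2.2 (2.17), `p = q = 1`, FOR THE LINE at `A = 0`**: `‖G^Π_k(s)‖_{1→1} ≤ c₀`, i.e. `Σ_{x}|G^Π_k(s)(x,x')| ≤ c₀` for every `x'`
(symmetry of `G^Π_k(s)`, `boxLine_isSymm`). [cite: Balaban1983RegularityDecay, Lemma 2.2 (2.17) p.578, for the two-cutoff line] -/
theorem lemma22_line_box_colSum (d ℓ : ℕ) (hℓ : 1 ≤ ℓ) (amin aplus : ℝ) (ha : 0 < amin) :
    ∃ c₀ : ℝ, 0 < c₀ ∧ ∀ (k : ℕ), 1 ≤ k → ∀ (a s : ℝ), amin ≤ a → a ≤ aplus → 0 ≤ s →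
      s ≤ 1 → ∀ (M : Fin (d + 1) → ℕ), (∀ i, 1 ≤ M i) →
      ∀ x' : ↥(boxDom (fun i => (ℓ + 1) ^ k * M i)),
        ∑ x, |(boxLine (ℓ + 1) (Nat.one_le_pow k (ℓ + 1) (Nat.succ_pos ℓ)) M (B1.aSeq a ((ℓ : ℝ) + 1) k) s)⁻¹ x x'| ≤ c₀ := by
  obtain ⟨δ₀, c₀, hδ0, hc0, h⟩ := thm110_line_box_roww d ℓ hℓ amin aplus ha
  refine ⟨c₀, hc0, ?_⟩
  intro k hk a s h1 h2 h3 h4 M hM x'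
  exact (colSum_le_roww hδ0.le _ (boxLine_isSymm (ℓ + 1) (Nat.one_le_pow k (ℓ + 1) (Nat.succ_pos ℓ)) _ s).inv x').trans (h k hk a s h1 h2 h3 h4 M hM x')

/-- **`‖G^Π_k(s)f‖_∞ ≤ c₀‖f‖_∞`** — (2.16)/(2.17) for the line at `A = 0` in the printed operator form (`D = 0` in the value bound).
[cite: Balaban1983RegularityDecay, Lemma 2.2 (2.16)–(2.17) p.577–578, for the two-cutoff line] -/
theorem lemma22_line_box_sup (d ℓ : ℕ) (hℓ : 1 ≤ ℓ) (amin aplus : ℝ) (ha : 0 < amin) :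
    ∃ c₀ : ℝ, 0 < c₀ ∧ ∀ (k : ℕ), 1 ≤ k → ∀ (a s : ℝ), amin ≤ a → a ≤ aplus → 0 ≤ s →
      s ≤ 1 → ∀ (M : Fin (d + 1) → ℕ), (∀ i, 1 ≤ M i) →
      ∀ (f : ↥(boxDom (fun i => (ℓ + 1) ^ k * M i)) → ℝ) (F : ℝ), (∀ x', |f x'| ≤ F) →
      ∀ x : ↥(boxDom (fun i => (ℓ + 1) ^ k * M i)),
        |((boxLine (ℓ + 1) (Nat.one_le_pow k (ℓ + 1) (Nat.succ_pos ℓ)) M (B1.aSeq a ((ℓ : ℝ) + 1) k) s)⁻¹ *ᵥ f) x| ≤ c₀ * F := by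
  obtain ⟨δ₀, c₀, hδ0, hc0, h⟩ := thm110_line_box_value d ℓ hℓ amin aplus ha
  refine ⟨c₀, hc0, ?_⟩
  intro k hk a s h1 h2 h3 h4 M hM f F hF x
  have := h k hk a s h1 h2 h3 h4 M hM f F 0 hF x fun x' _ => supNorm_nonneg _
  simpa using this

/-! ### §4 The literal coefficient `a` of the line

The main theorem is stated through the running `a_k = B1.aSeq a L k = a·c_k` of (2.34); since `a ↦ a_k` is a linear bijection of
`]0, ∞[` (b04's `cK`, `aSeq_div_cK`), the bound holds equally for the box line `boxLine(L^k, M, a, s)` with the LITERAL averaging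
coefficient `a` ranging over any window `[a₋, a₊]` — the object of files 63–93 — with the constants of `[a₋, a₊/(1 − L^{-2})]`. -/

/-- **THEOREM (1.10), VALUE CLAUSE, FOR THE BOX LINE WITH THE LITERAL COEFFICIENT `a`**: the uniform weighted row bound for
`(boxLine(L^k, M, a, s))⁻¹ = (T^Π(s) + aQ_k^*Q_k)⁻¹` itself, `a ∈ [a₋, a₊]`, every `s ∈ [0,1]`, every `k ≥ 1`, every box.
[cite: Balaban1983RegularityDecay, Theorem (Prop. 2.1 of [1]) (1.10) p.573 with (1.6) p.572, for the two-cutoff line] -/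
theorem thm110_line_box_roww_coeff (d ℓ : ℕ) (hℓ : 1 ≤ ℓ) (amin aplus : ℝ) (ha : 0 < amin) :
    ∃ δ₀ c₀ : ℝ, 0 < δ₀ ∧ 0 < c₀ ∧ ∀ (k : ℕ), 1 ≤ k → ∀ (a s : ℝ), amin ≤ a → a ≤ aplus → 0 ≤ s →
      s ≤ 1 → ∀ (M : Fin (d + 1) → ℕ), (∀ i, 1 ≤ M i) → ∀ x : ↥(boxDom (fun i => (ℓ + 1) ^ k * M i)),
        ∑ x', |(boxLine (ℓ + 1) (Nat.one_le_pow k (ℓ + 1) (Nat.succ_pos ℓ)) M a s)⁻¹ x x'|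
            * Real.exp (δ₀ * supNorm (x.1 - x'.1) / (((ℓ + 1) ^ k : ℕ) : ℝ)) ≤ c₀ := by
  obtain ⟨hr0, hr1⟩ := Linv_sq_bounds hℓ
  obtain ⟨δ₀, c₀, hδ0, hc0, h⟩ :=
    thm110_line_box_roww d ℓ hℓ amin (aplus / (1 - ((((ℓ : ℝ) + 1)) ^ 2)⁻¹)) ha
  refine ⟨δ₀, c₀, hδ0, hc0, ?_⟩
  intro k hk a s h1 h2 h3 h4 M hM x
  have hc := cK_pos hℓ hk
  have hA1 : amin ≤ a / cK ℓ k := by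
    rw [le_div_iff₀ hc]
    calc amin * cK ℓ k ≤ amin * 1 := mul_le_mul_of_nonneg_left (cK_le_one hℓ hk) ha.le
      _ ≤ a := by linarith
  have hA2 : a / cK ℓ k ≤ aplus / (1 - ((((ℓ : ℝ) + 1)) ^ 2)⁻¹) :=
    div_le_div₀ (by linarith) h2 (by linarith) (oneSub_le_cK hℓ hk)
  have := h k hk (a / cK ℓ k) s hA1 hA2 h3 h4 M hM x
  rwa [aSeq_div_cK hℓ hk] at this

/-- … and the corresponding printed value clause for the box line with the literal coefficient, every `s ∈ [0,1]`.
[cite: Balaban1983RegularityDecay, Theorem (Prop. 2.1 of [1]) (1.10) p.573 with (1.6) p.572, for the two-cutoff line] -/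
theorem thm110_line_box_value_coeff (d ℓ : ℕ) (hℓ : 1 ≤ ℓ) (amin aplus : ℝ) (ha : 0 < amin) :
    ∃ δ₀ c₀ : ℝ, 0 < δ₀ ∧ 0 < c₀ ∧ ∀ (k : ℕ), 1 ≤ k → ∀ (a s : ℝ), amin ≤ a → a ≤ aplus → 0 ≤ s →
      s ≤ 1 → ∀ (M : Fin (d + 1) → ℕ), (∀ i, 1 ≤ M i) →
      ∀ (f : ↥(boxDom (fun i => (ℓ + 1) ^ k * M i)) → ℝ) (F D : ℝ), (∀ x', |f x'| ≤ F) →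
      ∀ x : ↥(boxDom (fun i => (ℓ + 1) ^ k * M i)), (∀ x', f x' ≠ 0 → D ≤ supNorm (x.1 - x'.1)) →
        |((boxLine (ℓ + 1) (Nat.one_le_pow k (ℓ + 1) (Nat.succ_pos ℓ)) M a s)⁻¹ *ᵥ f) x|
          ≤ c₀ * Real.exp (-(δ₀ * D / (((ℓ + 1) ^ k : ℕ) : ℝ))) * F := by
  obtain ⟨δ₀, c₀, hδ0, hc0, h⟩ := thm110_line_box_roww_coeff d ℓ hℓ amin aplus ha
  refine ⟨δ₀, c₀, hδ0, hc0, ?_⟩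
  intro k hk a s h1 h2 h3 h4 M hM f F D hF x hD
  exact mulVec_le_of_roww hδ0.le _ _ x (h k hk a s h1 h2 h3 h4 M hM x) f hF hD

/-! ## §5 Non-vacuity: the hypotheses are met (`d + 1 = 4`, `L = 2`, window `a ∈ [1/2, 2]`, every `s ∈ [0,1]`) -/

/-- the main theorem at the physical dimension `d + 1 = 4`, `L = 2`. -/
example : ∃ δ₀ c₀ : ℝ, 0 < δ₀ ∧ 0 < c₀ ∧ ∀ (k : ℕ), 1 ≤ k → ∀ (a s : ℝ), (1 / 2 : ℝ) ≤ a → a ≤ 2 → 0 ≤ s →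
      s ≤ 1 → ∀ (M : Fin (3 + 1) → ℕ), (∀ i, 1 ≤ M i) → ∀ x : ↥(boxDom (fun i => (1 + 1) ^ k * M i)),
        ∑ x', |(boxLine (1 + 1) (Nat.one_le_pow k (1 + 1) (Nat.succ_pos 1)) M a s)⁻¹ x x'|
            * Real.exp (δ₀ * supNorm (x.1 - x'.1) / (((1 + 1) ^ k : ℕ) : ℝ)) ≤ c₀ :=
  thm110_line_box_roww_coeff 3 1 le_rfl (1 / 2) 2 (by norm_num)

/-- the quantifier prefix of the theorems is inhabited: `k = 1`, `a = 1`, `s = ½`, the unit cube `M ≡ 1`, and the fine box is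
non-empty (it contains the origin). -/
example : (1 : ℕ) ≤ 1 ∧ (1 / 2 : ℝ) ≤ 1 ∧ (1 : ℝ) ≤ 2 ∧ (0 : ℝ) ≤ 1 / 2 ∧ (1 / 2 : ℝ) ≤ 1
    ∧ (∀ i : Fin (3 + 1), 1 ≤ (fun _ => 1 : Fin (3 + 1) → ℕ) i)
    ∧ (fun _ => (0 : ℤ)) ∈ boxDom (fun i : Fin (3 + 1) => (1 + 1) ^ 1 * (fun _ => 1 : Fin (3 + 1) → ℕ) i) := by
  refine ⟨le_rfl, by norm_num, by norm_num, by norm_num, by norm_num, fun _ => le_rfl, ?_⟩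
  exact mem_boxDom.2 fun _ => ⟨le_rfl, by norm_num⟩

end Summit.QuantumFields.BalabanUV.T4Continuum.NE7K1LinBoxThm110

end
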